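import Literature.NumberTheory.Automorphic.CDTTheorem722ThreeFactsProofs
import Literature.NumberTheory.EllipticCurves.IsogenyFrobeniusTraceHoldsProofs
import Literature.NumberTheory.EllipticCurves.CuspFormLFunctionLevelConductorOfCarayolProofs
import Literature.NumberTheory.EllipticCurves.OggFormulaPotGoodOrdinaryTwoProofs
import Literature.NumberTheory.EllipticCurves.HasseWeilAbelianConductorSwanIndependenceTwoProofs
import HarnessLib

/-!
# Stub ideation `stub_threeImpTwo` (S9) — ideator k = 1, generation 9 (FAMILY 1: recognise & import)

Companion of `STUB-IDEAS-stub_threeImpTwo-1.md` (gen 9).  Crux `FreyModularity` (stmt-ABC-11340),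
skeleton `Lines/Sketch.lean` (sha 21576c53), stub `stub_threeImpTwo` :186 (verbatim type = `SigS9`).

The ONE move of this generation: the skeleton's OWN registered closer
`stub_threeImpTwo_of_two_facts hES hC` (:584) has had its second binder
`hC : ∀ N [NeZero N], IsNewformOf.level_eq_conductorNorm (N := N)` DISCHARGED IN THE TREE
(2026-08-28, `CuspFormLFunctionLevelConductorOfCarayolProofs`:
`IsNewformOf.forall_level_eq_conductorNorm_of_carayol1986_of_saito`) from the named facts
`Carayol1986_artinConductorExponent` and Saito's `p = 2` half of Ogg's formula; and Saito's half is
itself reduced in the tree to ONE prime (`…_of_three`) and to the additive potentially-good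
supersingular corner at `2` (`…_of_valuation_j_lt_one`).  Everything below is BY NAME; Plan A has no
transcription at all; Plan B is the pointwise (one-curve) re-thread of `CDTTheorem722Proofs`
`isModular_of_isModularGaloisRepTate_of_facts` (:674–700) with level = conductor for THAT curve.
-/

noncomputable section

open scoped NumberField MatrixGroups ModularForm
open NumberField IsDedekindDomain CongruenceSubgroup
open Literature.NumberTheory.EllipticCurves
open Literature.NumberTheory.EllipticCurves.ModularForms
open Literature.NumberTheory.Automorphic
open Literature.NumberTheory.Automorphic.BCDT
open Literature.NumberTheory.GaloisRepresentations
open WeierstrassCurve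

namespace Summit.ABC.ABC.Cruxes.FreyModularity.Sketch.StubIdeasThreeImpTwo1G9

/-! ## §0 Currencies -/

/-- The registered stub's type, character for character (`Lines/Sketch.lean` :186). -/
def SigS9 : Prop :=
  ∀ (W : WeierstrassCurve ℚ) [W.IsElliptic] [NeZero (W.conductorNorm ℤ)] (ℓ : ℕ) [Fact ℓ.Prime],
    W.IsModularGaloisRepTate ℓ → BCDT.IsModular W

example : SigS9 = (∀ (W : WeierstrassCurve ℚ) [W.IsElliptic] [NeZero (W.conductorNorm ℤ)] (ℓ : ℕ)
    [Fact ℓ.Prime], W.IsModularGaloisRepTate ℓ → BCDT.IsModular W) := rfl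

/-- `hC`, the second binder of the skeleton closer `stub_threeImpTwo_of_two_facts` (:584), verbatim. -/
def CarayolLevel : Prop :=
  ∀ (N : ℕ) [NeZero N], IsNewformOf.level_eq_conductorNorm (N := N)

/-- Saito's `p = 2` half of Ogg's formula for every curve over `ℚ` and every `ℓ` — verbatim the binder
`hS` of the tree theorem `IsNewformOf.forall_level_eq_conductorNorm_of_carayol1986_of_saito`. -/
def SaitoTwoAll : Prop :=
  ∀ (V : WeierstrassCurve ℚ) (ℓ : ℕ) [Fact ℓ.Prime],
    V.swanConductorAt_rationalTate_eq_wildConductorExponent_of_ringChar_eq_two ℓ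

/-- The same at the single prime `ℓ = 3` (the `3`-adic Tate module above `2`). -/
def SaitoTwoAtThree : Prop :=
  ∀ (V : WeierstrassCurve ℚ), V.swanConductorAt_rationalTate_eq_wildConductorExponent_of_ringChar_eq_two 3

attribute [local instance] AddSubgroup.torsionBy.zmodModule in
/-- The finest residual of Saito's theorem over `ℚ` the tree leaves open (hypothesis `H` of
`swanConductorAt_rationalTate_eq_wildConductorExponent_of_ringChar_eq_two_of_valuation_j_lt_one`,
`OggFormulaPotGoodOrdinaryTwoProofs` :982, quantified over the curve): additive, potentially good
reduction at `2` with `|j|₂ < 1` (supersingular special fibre), in `3`-torsion form. -/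
def SaitoTwoSupersingularResidual : Prop :=
  ∀ (V : WeierstrassCurve ℚ) [V.IsElliptic],
    V.HasAdditiveReductionAt ((Rat.HeightOneSpectrum.primesEquiv (R := 𝓞 ℚ)).symm ⟨2, Nat.prime_two⟩) →
    ((Rat.HeightOneSpectrum.primesEquiv (R := 𝓞 ℚ)).symm ⟨2, Nat.prime_two⟩).valuation ℚ V.j < 1 →
    ∃ 𝔓 ∈ ((Rat.HeightOneSpectrum.primesEquiv (R := 𝓞 ℚ)).symm ⟨2, Nat.prime_two⟩).primesAbove,
      (V.torsionGaloisRep 3).swanConductorAt (𝓞 ℚ) 𝔓 =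
        (V.wildConductorExponent
          ((Rat.HeightOneSpectrum.primesEquiv (R := 𝓞 ℚ)).symm ⟨2, Nat.prime_two⟩) : ℝ)

/-- The first bullet of `eichlerShimuraConstruction` alone — exactly what
`isModular_of_isModularGaloisRepTate_of_facts` consumes (`obtain ⟨W', hW', hW'f, -⟩ := hES hf hint`);
the period-lattice clause is never used on the (3) ⇒ (2) road. -/
def WeakES : Prop :=
  ∀ {N : ℕ} [NeZero N] {f : CuspForm (Gamma0 N) 2}, IsNewform0 f →
    (∀ n : ℕ, ∃ a : ℤ, cuspCoeff f n = a) →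
    ∃ (W : WeierstrassCurve ℚ) (_ : W.IsElliptic), IsNewformOf W f

/-! ## §1 Plan A — by name, zero transcription -/

/-- **H1 (XS, PROVED).** Saito's half at every `ℓ` from its `ℓ = 3` instance
(`…_of_ringChar_eq_two_of_three`, Silverman ATAEC IV.10.2(c)). -/
theorem saitoTwoAll_of_atThree (h : SaitoTwoAtThree) : SaitoTwoAll :=
  fun V ℓ _ ↦ V.swanConductorAt_rationalTate_eq_wildConductorExponent_of_ringChar_eq_two_of_three ℓ (h V)

attribute [local instance] AddSubgroup.torsionBy.zmodModule in
/-- **H2 (XS, PROVED).** Saito's half for all curves over `ℚ` from the supersingular corner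
(`…_of_ringChar_eq_two_of_valuation_j_lt_one`: `|j|₂ ≥ 1` and `|j|₂ > 1`… are theorems of the tree). -/
theorem saitoTwoAll_of_residual (H : SaitoTwoSupersingularResidual) : SaitoTwoAll :=
  fun V ℓ _ ↦
    V.swanConductorAt_rationalTate_eq_wildConductorExponent_of_ringChar_eq_two_of_valuation_j_lt_one ℓ
      (H V)

/-- **H3 (XS, PROVED).** The skeleton closer's binder `hC` from Carayol (A) + Saito-at-2
(the tree's 2026-08-28 theorem, by name). -/
theorem carayolLevel_of_carayol1986_of_saito (hCA : Carayol1986_artinConductorExponent)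
    (hS : SaitoTwoAll) : CarayolLevel :=
  IsNewformOf.forall_level_eq_conductorNorm_of_carayol1986_of_saito hCA hS

/-- **H4 (XS, PROVED).** The verbatim stub from {`eichlerShimuraConstruction`,
`Carayol1986_artinConductorExponent`, Saito-at-2 ∀ curves} — the skeleton's own closer
`stub_threeImpTwo_of_two_facts` with `hC` discharged. -/
theorem sigS9_of_ES_of_carayol1986_of_saito (hES : eichlerShimuraConstruction)
    (hCA : Carayol1986_artinConductorExponent) (hS : SaitoTwoAll) : SigS9 :=
  fun W _ _ ℓ _ h ↦
    isModular_of_isModularGaloisRepTate_of_three_facts hES isIsogenous_iff_frobeniusTrace_eq_holds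
      (carayolLevel_of_carayol1986_of_saito hCA hS) W ℓ h

/-- **Gen-9 closer (PROVED): the stub, typed LITERALLY as the skeleton states it, from the three
catalogued named facts, Saito's entering only through its open supersingular corner.**
(`isModular_of_isModularGaloisRepTate_of_three_facts hES isIsogenous_iff_frobeniusTrace_eq_holds` is
definitionally the skeleton's `stub_threeImpTwo_of_two_facts hES` / the tree's `_of_two_facts`.) -/
theorem stub_threeImpTwo_of_ES_of_carayol1986_of_saitoResidual (hES : eichlerShimuraConstruction)
    (hCA : Carayol1986_artinConductorExponent) (H : SaitoTwoSupersingularResidual) :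
    ∀ (W : WeierstrassCurve ℚ) [W.IsElliptic] [NeZero (W.conductorNorm ℤ)] (ℓ : ℕ) [Fact ℓ.Prime],
      W.IsModularGaloisRepTate ℓ → BCDT.IsModular W :=
  sigS9_of_ES_of_carayol1986_of_saito hES hCA (saitoTwoAll_of_residual H)

/-- The same with Saito's half at the single prime `3` (H1). -/
theorem stub_threeImpTwo_of_ES_of_carayol1986_of_saitoThree (hES : eichlerShimuraConstruction)
    (hCA : Carayol1986_artinConductorExponent) (h3 : SaitoTwoAtThree) :
    ∀ (W : WeierstrassCurve ℚ) [W.IsElliptic] [NeZero (W.conductorNorm ℤ)] (ℓ : ℕ) [Fact ℓ.Prime],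
      W.IsModularGaloisRepTate ℓ → BCDT.IsModular W :=
  sigS9_of_ES_of_carayol1986_of_saito hES hCA (saitoTwoAll_of_atThree h3)

/-! ## §2 Plan B — pointwise (one curve), level = conductor for THAT curve only -/

/-- **H5 (XS, PROVED).** `eichlerShimuraConstruction → WeakES` (drop the lattice clause). -/
theorem weakES_of_ES (hES : eichlerShimuraConstruction) : WeakES := by
  intro N _ f hf hint
  obtain ⟨W, hW, hWf, -⟩ := hES hf hint
  exact ⟨W, hW, hWf⟩

/-- **H6 (S, PROVED): pointwise (3) ⇒ (2).**  For ONE elliptic `W/ℚ`: if every newform of `W` (at any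
level) has level `N_W` — `hCW`, level = conductor FOR THIS CURVE — then `ρ_{W,ℓ}` modular ⇒ `W`
modular, granted `WeakES` only.  Proof = `isModular_of_isModularGaloisRepTate_of_facts`
(CDTTheorem722Proofs :674–700) with `hL`, `hF` discharged by the tree
(`exists_rational_isNewform0_of_isModularGaloisRepTate'`, `isIsogenous_iff_frobeniusTrace_eq_holds`)
and `hC N hWf` replaced by `hCW hWf`. -/
theorem isModular_of_isModularGaloisRepTate_of_weakES_of_levelEq (hES₁ : WeakES)
    (W : WeierstrassCurve ℚ) [W.IsElliptic] [NeZero (W.conductorNorm ℤ)]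
    (hCW : ∀ {N : ℕ} [NeZero N] {f : CuspForm (Gamma0 N) 2}, IsNewformOf W f → N = W.conductorNorm ℤ)
    (ℓ : ℕ) [Fact ℓ.Prime] (h : W.IsModularGaloisRepTate ℓ) : BCDT.IsModular W := by
  classical
  have hℓp : ℓ.Prime := Fact.out
  obtain ⟨N, hN, f, hf, hint, hcoeff⟩ := exists_rational_isNewform0_of_isModularGaloisRepTate' W ℓ h
  haveI : NeZero (N * (ℓ * W.conductorNorm ℤ)) :=
    ⟨mul_ne_zero (NeZero.ne N) (mul_ne_zero hℓp.ne_zero (NeZero.ne _))⟩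
  obtain ⟨W', hW', hW'f⟩ := hES₁ hf hint
  have hiso : IsIsogenous W W' := by
    refine WeierstrassCurve.isIsogenous_of_finite_setOf_LFunction_ne
      isIsogenous_iff_frobeniusTrace_eq_holds W W' ?_
    refine (N * (ℓ * W.conductorNorm ℤ)).primeFactors.finite_toSet.subset ?_
    rintro p ⟨hp, hne⟩
    refine (Nat.mem_primeFactors_of_ne_zero (NeZero.ne _)).mpr ⟨hp, ?_⟩
    by_contra hpM
    exact hne (by exact_mod_cast (hcoeff p hp hpM).symm.trans (hW'f.2 p))
  have hWf : IsNewformOf W f := ⟨hf, fun n ↦ by rw [hW'f.2 n, hiso.LFunction_eq]⟩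
  have hNE : N = W.conductorNorm ℤ := hCW hWf
  subst hNE
  exact ⟨f, hWf⟩

/-- **H7 (XS, PROVED): pointwise closer with Saito FOR THE CURVE AT HAND at the single prime `3`**
(Carayol (A) for level = conductor at odd places and at a non-additive `2`; Saito only if `W` is
additive at `2`).  This is the form k2's route-minimal recut consumes: on Frey curves the `ℓ = 3`
Saito instance is LANDED (`Summit.ABC.ABC.Theorems.swanConductorAt_torsion_three_freyCurve_of_two_mul`
via k2 g6 :1696). -/
theorem isModular_of_isModularGaloisRepTate_pointwise (hES₁ : WeakES)
    (hCA : Carayol1986_artinConductorExponent) (W : WeierstrassCurve ℚ) [W.IsElliptic]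
    [NeZero (W.conductorNorm ℤ)]
    (hS3 : W.swanConductorAt_rationalTate_eq_wildConductorExponent_of_ringChar_eq_two 3)
    (ℓ : ℕ) [Fact ℓ.Prime] (h : W.IsModularGaloisRepTate ℓ) : BCDT.IsModular W :=
  isModular_of_isModularGaloisRepTate_of_weakES_of_levelEq hES₁ W
    (fun hWf ↦ IsNewformOf.level_eq_conductorNorm_of_carayol1986_of_saito hCA
      (fun ℓ' _ ↦ W.swanConductorAt_rationalTate_eq_wildConductorExponent_of_ringChar_eq_two_of_three
        ℓ' hS3) hWf) ℓ h

/-- **H8 (XS, PROVED): Saito-free pointwise closer for curves with no additive place of residue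
characteristic `2`** (Carayol (A) alone: `…_of_forall_not_hasAdditiveReductionAt_two`). -/
theorem isModular_of_isModularGaloisRepTate_pointwise_of_not_additive_two (hES₁ : WeakES)
    (hCA : Carayol1986_artinConductorExponent) (W : WeierstrassCurve ℚ) [W.IsElliptic]
    [NeZero (W.conductorNorm ℤ)]
    (h2 : ∀ w : HeightOneSpectrum (𝓞 ℚ), ringChar (𝓞 ℚ ⧸ w.asIdeal) = 2 → ¬ W.HasAdditiveReductionAt w)
    (ℓ : ℕ) [Fact ℓ.Prime] (h : W.IsModularGaloisRepTate ℓ) : BCDT.IsModular W :=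
  isModular_of_isModularGaloisRepTate_of_weakES_of_levelEq hES₁ W
    (fun hWf ↦
      IsNewformOf.level_eq_conductorNorm_of_carayol1986_of_forall_not_hasAdditiveReductionAt_two hCA
        hWf h2) ℓ h

/-- **H9 (XS, PROVED): the verbatim stub from `WeakES` + Carayol (A) + Saito at `ℓ = 3` ∀ curves**
(Plan B's ∀-closure = Plan A with `eichlerShimuraConstruction` weakened to its first bullet). -/
theorem stub_threeImpTwo_of_weakES_of_carayol1986_of_saitoThree (hES₁ : WeakES)
    (hCA : Carayol1986_artinConductorExponent) (h3 : SaitoTwoAtThree) :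
    ∀ (W : WeierstrassCurve ℚ) [W.IsElliptic] [NeZero (W.conductorNorm ℤ)] (ℓ : ℕ) [Fact ℓ.Prime],
      W.IsModularGaloisRepTate ℓ → BCDT.IsModular W :=
  fun W _ _ ℓ _ h ↦ isModular_of_isModularGaloisRepTate_pointwise hES₁ hCA W (h3 W) ℓ h

end Summit.ABC.ABC.Cruxes.FreyModularity.Sketch.StubIdeasThreeImpTwo1G9

end
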